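import Summits.BirchSwinnertonDyer.BirchSwinnertonDyer.Theorems.EisensteinDepletionAtTwoStarKummerDoorA

/-!
# Line `kummer` of crux `StarGO2Sigma` (stmt-BirchSwinnertonDyer-27046) — THE DOOR, part B: the cover, THEOREMS A+B against the
# generator, the bundled Γ₁-law (lead bsd-rank2-star-p1 GEN 13, 2026-08-28)

Verbatim from the registered skeleton v7.4: print handles `stub_ubd` (Calegari–Dimitrov–Tang) and `stub_levelEqConductor` (Carayol),
the closed stubs 2 and 3, the v4 glue `gammaOneParity_of_cover` (cover + UBD ⟹ Γ₁-parity, through the congruence core in every weight),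
the v6 glue `gammaOneCover_of_cut`, and `gammaOneLaw_of`.

HONEST FRAMING (Barrier B1): these files are the KERNEL GLUE of an OPEN crux made into tree theorems; the end state
`starGO2Sigma_of_prints` is CONDITIONAL on four PUBLISHED theorems that the tree holds only as named facts / print stubs
(Rademacher's `log η` law, Calegari–Dimitrov–Tang unbounded denominators, Carayol level = conductor, Edixhoven ∧ Abbes–Ullmo on the
Manin constant).  Nothing here reads an analytic rank; `StarGO2Sigma` (27046), E1M_NSF (27021), E1M and BSD are NOT proved
(PARTITION D-0054: none — r_an ≥ 2, axis S0).
-/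

set_option linter.dupNamespace false
set_option autoImplicit false

noncomputable section

namespace Summit.BirchSwinnertonDyer.BirchSwinnertonDyer.Theorems.DepletionAtTwo.KummerDoor

open scoped MatrixGroups ModularForm
open CongruenceSubgroup
open Literature.NumberTheory.EllipticCurves
open Literature.NumberTheory.EllipticCurves.Greenberg1999
open Literature.NumberTheory.EllipticCurves.ModularForms
open Literature.NumberTheory.ModularForms
open Summit.BirchSwinnertonDyer.BirchSwinnertonDyer.Theorems.DepletionAtTwo
open scoped Manifold

/-- PRINT handle `stub_ubd`: the unbounded denominators theorem (Calegari–Dimitrov–Tang 2025, Thm. 1.0.1) — the tree's NAMED FACT.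
(By-name `Prop` handle of this file; no cite tag, not a Literature fact.) -/
def stub_ubd : Prop := Literature.NumberTheory.Automorphic.CalegariDimitrovTang2025_unboundedDenominators

/-- PRINT handle `stub_levelEqConductor`: Carayol — the level of the newform of `W` is its conductor (`IsNewformOf.level_eq_conductorNorm`,
a named statement of the tree).
(By-name `Prop` handle of this file; no cite tag, not a Literature fact.) -/
def stub_levelEqConductor : Prop := ∀ (N : ℕ) [NeZero N], IsNewformOf.level_eq_conductorNorm (N := N)

/-- v5's cover statement `stub_gammaOneCover` (VERBATIM), as a `Prop`.
(By-name `Prop` handle of this file; no cite tag, not a Literature fact.) -/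
def stub_gammaOneCover : Prop :=
    ∀ (W : WeierstrassCurve ℚ) [W.IsElliptic] [W.IsGloballyMinimal] (W₀ : WeierstrassCurve ℚ) [W₀.IsElliptic]
      [W₀.IsGloballyMinimal] ⦃N : ℕ⦄ [NeZero N] (f : CuspForm (Gamma0 N) 2), IsNewformOf W f → IsNewformOf W₀ f →
      IsOrdinaryAt W 2 → N = W.conductorNorm ℤ →
      ∀ (L₀ : PeriodPair), IsNeronLatticeOf (W₀.baseChange ℂ) L₀ → ∀ (q : ℚ), q ≠ 0 →
      (∀ z ∈ periodLattice f, (q : ℂ) * z ∈ L₀.lattice) → (∀ z ∈ L₀.lattice, ∃ w ∈ periodLattice f, z = (q : ℂ) * w) →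
      ∀ (x₀ : ℚ), HasRationalTwoTorsionX W₀ x₀ → ¬ TwoTorsionRamifiedAtTwo x₀ →
      ∀ (lam : ℂ), lam ∈ L₀.lattice → lam / 2 ∉ L₀.lattice →
      L₀.weierstrassP (lam / 2) - ((W₀.b₂ : ℚ) : ℂ) / 12 = ((x₀ : ℚ) : ℂ) →
      (∃ β : ℕ → ℕ, IsAdmissibleStabData (W.conductorNorm ℤ) β) →
      ∃ β : ℕ → ℕ, IsAdmissibleStabData (W.conductorNorm ℤ) β ∧ ∀ g' : ℚ,
        (∀ x : ℚ, (∃ γ : Gamma0 N,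
          stabEisensteinPeriod (W.conductorNorm ℤ) β ((γ : SL(2, ℤ)) 0 0) ((γ : SL(2, ℤ)) 0 1)
            ((γ : SL(2, ℤ)) 1 0) ((γ : SL(2, ℤ)) 1 1) = x) ↔ ∃ n : ℤ, x = n * g') →
        g' ≠ 0 ∧
        (∀ γ : SL(2, ℤ), γ ∈ Gamma1 N → (γ : Matrix (Fin 2) (Fin 2) ℤ).trace = 2 →
          ∃ n : ℤ, stabEisensteinPeriod (W.conductorNorm ℤ) β (γ 0 0) (γ 0 1) (γ 1 0) (γ 1 1) = n * g' ∧ Even n) ∧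
        (∀ Γ'' : Subgroup SL(2, ℤ),
          (∀ γ : SL(2, ℤ), γ ∈ Γ'' ↔ ∃ hγ : γ ∈ Gamma0 N, γ ∈ Gamma1 N ∧
            ((∃ n : ℤ, stabEisensteinPeriod (W.conductorNorm ℤ) β (γ 0 0) (γ 0 1) (γ 1 0) (γ 1 1) = n * g' ∧ Even n) ↔
              ∃ k : ℤ, ∃ w ∈ L₀.lattice, (q : ℂ) * cuspSymbol f ⟨γ, hγ⟩ = (k : ℂ) * lam + 2 * w)) →
          (∃ γ₀ ∈ Gamma1 N, γ₀ ∉ Γ'') →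
          ∃ (k : ℤ) (h : CuspForm Γ'' k) (M : ℕ),
            (h : UpperHalfPlane → ℂ) ≠ 0 ∧
            (∀ γ ∈ Gamma1 N, γ ∉ Γ'' → (h : UpperHalfPlane → ℂ) ∣[k] γ = -h) ∧
            M ≠ 0 ∧
            ∀ n : ℕ, ∃ z : ℤ,
              PowerSeries.coeff n
                (UpperHalfPlane.qExpansion (1 : ℝ) (fun τ : UpperHalfPlane ↦ (M : ℂ) * h τ)) = (z : ℂ)) ∧
        (∃ b d : ℤ, 0 < d ∧ Int.gcd d (b * (W.conductorNorm ℤ : ℕ)) = 1 ∧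
          ∃ n' : ℤ, stabEisensteinPeriod (W.conductorNorm ℤ) β (Int.gcdA d (b * (W.conductorNorm ℤ : ℕ))) b
            (-((W.conductorNorm ℤ : ℕ) : ℤ) * Int.gcdB d (b * (W.conductorNorm ℤ : ℕ))) d = n' * g' ∧ Odd n')

/-! ### By-name handles -/

/-- By-name handle of stub 1a.
(By-name `Prop` handle of this file; no cite tag, not a Literature fact.) -/
def stub_eisImageCyclic : Prop := type_of% KummerStubs.stub_eisImageCyclic

/-- By-name handle of stub 2.
(By-name `Prop` handle of this file; no cite tag, not a Literature fact.) -/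
def stub_kummerParityHom : Prop := type_of% KummerStubs.stub_kummerParityHom

/-- By-name handle of stub 3.
(By-name `Prop` handle of this file; no cite tag, not a Literature fact.) -/
def stub_characterOfGamma0 : Prop := type_of% KummerStubs.stub_characterOfGamma0

/-- **v4 GLUE (lead star-p1 GEN 9, kernel-checked, no sorry): v3's research stub `stub_gammaOneParity` from the cover stub and
unbounded denominators.**  For `γ ∈ Γ₁(N)` with `φ_β(γ) = n g'`: the discrepancy kernel `Γ″` exists
(`TwistedParityGroup.exists_twistedParityGroup`: `φ_β` additive on `Γ₀(N)` by the tree's `stabEisensteinPeriod_mul`, values in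
`ℤg'` by the generator property); if `γ ∈ Γ″`, its membership is clause (ii) at `γ` (the integer `n` is unique as `g' ≠ 0`); if
`γ ∉ Γ″`, then `Γ″ ≠ Γ₁(N)`, (ii-b) gives `(h, M)`, (ii-a) + `cuspSymbol_eq_zero_of_discr_eq_zero` put every unipotent of
`Γ₁(N)` in `Γ″` (`mem_of_trace_eq_two_of_cuspEven`), `Γ″` has finite index (`finiteIndex_of_twistedParity`), and the congruence
core IN EVERY WEIGHT (`CongruenceCore.false_of_antiinvariant_integral_cuspForm_wt`, lead GEN 10 p644813: UBD + Wohlfahrt PROVED +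
`Γ₁ = ⟨Γ(N), T⟩`) is a contradiction. -/
theorem gammaOneParity_of_cover : stub_gammaOneCover → stub_ubd →
    ∀ (W : WeierstrassCurve ℚ) [W.IsElliptic] [W.IsGloballyMinimal] (W₀ : WeierstrassCurve ℚ) [W₀.IsElliptic]
      [W₀.IsGloballyMinimal] ⦃N : ℕ⦄ [NeZero N] (f : CuspForm (Gamma0 N) 2), IsNewformOf W f → IsNewformOf W₀ f →
      IsOrdinaryAt W 2 → N = W.conductorNorm ℤ →
      ∀ (L₀ : PeriodPair), IsNeronLatticeOf (W₀.baseChange ℂ) L₀ → ∀ (q : ℚ), q ≠ 0 →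
      (∀ z ∈ periodLattice f, (q : ℂ) * z ∈ L₀.lattice) → (∀ z ∈ L₀.lattice, ∃ w ∈ periodLattice f, z = (q : ℂ) * w) →
      ∀ (x₀ : ℚ), HasRationalTwoTorsionX W₀ x₀ → ¬ TwoTorsionRamifiedAtTwo x₀ →
      ∀ (lam : ℂ), lam ∈ L₀.lattice → lam / 2 ∉ L₀.lattice →
      L₀.weierstrassP (lam / 2) - ((W₀.b₂ : ℚ) : ℂ) / 12 = ((x₀ : ℚ) : ℂ) →
      (∃ β : ℕ → ℕ, IsAdmissibleStabData (W.conductorNorm ℤ) β) →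
      ∃ β : ℕ → ℕ, IsAdmissibleStabData (W.conductorNorm ℤ) β ∧ ∀ g' : ℚ,
        (∀ x : ℚ, (∃ γ : Gamma0 N,
          stabEisensteinPeriod (W.conductorNorm ℤ) β ((γ : SL(2, ℤ)) 0 0) ((γ : SL(2, ℤ)) 0 1)
            ((γ : SL(2, ℤ)) 1 0) ((γ : SL(2, ℤ)) 1 1) = x) ↔ ∃ n : ℤ, x = n * g') →
        g' ≠ 0 ∧
        (∀ γ : Gamma0 N, (N : ℤ) ∣ (γ : SL(2, ℤ)) 1 1 - 1 → ∀ n : ℤ,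
          stabEisensteinPeriod (W.conductorNorm ℤ) β ((γ : SL(2, ℤ)) 0 0) ((γ : SL(2, ℤ)) 0 1)
            ((γ : SL(2, ℤ)) 1 0) ((γ : SL(2, ℤ)) 1 1) = n * g' →
          (Even n ↔ ∃ k : ℤ, ∃ w ∈ L₀.lattice, (q : ℂ) * cuspSymbol f γ = (k : ℂ) * lam + 2 * w)) ∧
        (∃ b d : ℤ, 0 < d ∧ Int.gcd d (b * (W.conductorNorm ℤ : ℕ)) = 1 ∧
          ∃ n' : ℤ, stabEisensteinPeriod (W.conductorNorm ℤ) β (Int.gcdA d (b * (W.conductorNorm ℤ : ℕ))) b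
            (-((W.conductorNorm ℤ : ℕ) : ℤ) * Int.gcdB d (b * (W.conductorNorm ℤ : ℕ))) d = n' * g' ∧ Odd n') := by
  intro hC hU W _ _ W₀ _ _ N _ f hf hf₀ hord hN L₀ hL₀ q hq hin hout x₀ hx₀ hnr lam hlam hlam2 h℘ hβ
  dsimp only [stub_gammaOneCover, stub_ubd] at hC hU
  obtain ⟨β, hadm, H⟩ := hC W W₀ f hf hf₀ hord hN L₀ hL₀ q hq hin hout x₀ hx₀ hnr lam hlam hlam2 h℘ hβ
  refine ⟨β, hadm, fun g' hg ↦ ?_⟩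
  obtain ⟨hg0, hcusp, hcover, hbez⟩ := H g' hg
  refine ⟨hg0, ?_, hbez⟩
  intro γ hd n hn
  have hN0 : N ≠ 0 := NeZero.ne N
  -- `γ ∈ Γ₁(N)`: `c ≡ 0`, `d ≡ 1`, and `ad - bc = 1` gives `a ≡ 1`
  have hγ0 : (γ : SL(2, ℤ)) ∈ Gamma0 N := γ.2
  have hc : (((γ : SL(2, ℤ)) 1 0 : ℤ) : ZMod N) = 0 := Gamma0_mem.mp hγ0
  have hdZ : (((γ : SL(2, ℤ)) 1 1 : ℤ) : ZMod N) = 1 := by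
    have h := (ZMod.intCast_zmod_eq_zero_iff_dvd _ N).mpr hd
    rw [Int.cast_sub, Int.cast_one, sub_eq_zero] at h
    exact h
  have hγ1 : (γ : SL(2, ℤ)) ∈ Gamma1 N := by
    rw [Gamma1_mem]
    refine ⟨?_, hdZ, hc⟩
    have hdet : (γ : SL(2, ℤ)) 0 0 * (γ : SL(2, ℤ)) 1 1 - (γ : SL(2, ℤ)) 0 1 * (γ : SL(2, ℤ)) 1 0 = 1 := by
      have := Matrix.SpecialLinearGroup.det_coe (γ : SL(2, ℤ))
      rwa [Matrix.det_fin_two] at this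
    have h := congr_arg (fun z : ℤ ↦ (z : ZMod N)) hdet
    simp only [Int.cast_sub, Int.cast_mul, Int.cast_one, hdZ, hc, mul_one, mul_zero, sub_zero] at h
    exact h
  -- the additive Eisenstein period functional on `Γ₀(N)` with cyclic value group `ℤ·g'`
  subst hN
  have hdiv : ∀ δ : Gamma0 (W.conductorNorm ℤ), ((W.conductorNorm ℤ : ℕ) : ℤ) ∣ (δ : SL(2, ℤ)) 1 0 :=
    fun δ ↦ (ZMod.intCast_zmod_eq_zero_iff_dvd _ _).mp (Gamma0_mem.mp δ.2)
  have hφ : ∀ δ ε : Gamma0 (W.conductorNorm ℤ),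
      (fun δ : Gamma0 (W.conductorNorm ℤ) ↦ stabEisensteinPeriod (W.conductorNorm ℤ) β ((δ : SL(2, ℤ)) 0 0)
        ((δ : SL(2, ℤ)) 0 1) ((δ : SL(2, ℤ)) 1 0) ((δ : SL(2, ℤ)) 1 1)) (δ * ε) =
      (fun δ : Gamma0 (W.conductorNorm ℤ) ↦ stabEisensteinPeriod (W.conductorNorm ℤ) β ((δ : SL(2, ℤ)) 0 0)
        ((δ : SL(2, ℤ)) 0 1) ((δ : SL(2, ℤ)) 1 0) ((δ : SL(2, ℤ)) 1 1)) δ +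
      (fun δ : Gamma0 (W.conductorNorm ℤ) ↦ stabEisensteinPeriod (W.conductorNorm ℤ) β ((δ : SL(2, ℤ)) 0 0)
        ((δ : SL(2, ℤ)) 0 1) ((δ : SL(2, ℤ)) 1 0) ((δ : SL(2, ℤ)) 1 1)) ε :=
    fun δ ε ↦ stabEisensteinPeriod_mul (NeZero.ne _) hadm (hdiv δ) (hdiv ε)
  have hval : ∀ δ : Gamma0 (W.conductorNorm ℤ), ∃ m : ℤ,
      (fun δ : Gamma0 (W.conductorNorm ℤ) ↦ stabEisensteinPeriod (W.conductorNorm ℤ) β ((δ : SL(2, ℤ)) 0 0)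
        ((δ : SL(2, ℤ)) 0 1) ((δ : SL(2, ℤ)) 1 0) ((δ : SL(2, ℤ)) 1 1)) δ = m * g' :=
    fun δ ↦ (hg _).mp ⟨δ, rfl⟩
  have hin1 : ∀ z ∈ periodLatticeGamma1 f, (q : ℂ) * z ∈ L₀.lattice :=
    fun z hz ↦ hin z (periodLatticeGamma1_le_periodLattice f hz)
  obtain ⟨Γ'', hΓ⟩ := TwistedParityGroup.exists_twistedParityGroup f L₀ q hin1 hlam hlam2 _ hφ hg0 hval
  by_cases hmem : (γ : SL(2, ℤ)) ∈ Γ''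
  · -- membership IS clause (ii) at `γ`
    obtain ⟨hγ0', -, hM⟩ := (hΓ _).mp hmem
    have huniq : ∀ {m : ℤ}, stabEisensteinPeriod (W.conductorNorm ℤ) β ((γ : SL(2, ℤ)) 0 0) ((γ : SL(2, ℤ)) 0 1)
        ((γ : SL(2, ℤ)) 1 0) ((γ : SL(2, ℤ)) 1 1) = m * g' → m = n := by
      intro m hm
      have : (m : ℚ) = n := mul_right_cancel₀ hg0 (hm.symm.trans hn)
      exact_mod_cast this
    have hE : (∃ m : ℤ, stabEisensteinPeriod (W.conductorNorm ℤ) β ((γ : SL(2, ℤ)) 0 0) ((γ : SL(2, ℤ)) 0 1)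
        ((γ : SL(2, ℤ)) 1 0) ((γ : SL(2, ℤ)) 1 1) = m * g' ∧ Even m) ↔ Even n :=
      ⟨fun ⟨m, hm, he⟩ ↦ huniq hm ▸ he, fun he ↦ ⟨n, hn, he⟩⟩
    exact hE.symm.trans hM
  · -- otherwise the discrepancy cover exists and the congruence core refutes it
    exfalso
    haveI : Γ''.FiniteIndex :=
      TwistedParityGroup.finiteIndex_of_twistedParity f L₀ q hin1 hlam hlam2 _ hφ hg0 hval hΓ
    have hpar : ∀ γ' ∈ Gamma1 (W.conductorNorm ℤ), (γ' : Matrix (Fin 2) (Fin 2) ℤ).trace = 2 → γ' ∈ Γ'' :=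
      fun γ' hγ' htr ↦ TwistedParityGroup.mem_of_trace_eq_two_of_cuspEven f L₀ q
        (fun δ : Gamma0 (W.conductorNorm ℤ) ↦ stabEisensteinPeriod (W.conductorNorm ℤ) β ((δ : SL(2, ℤ)) 0 0)
          ((δ : SL(2, ℤ)) 0 1) ((δ : SL(2, ℤ)) 1 0) ((δ : SL(2, ℤ)) 1 1)) hΓ
        (fun γ'' _ hγ''1 htr'' ↦ hcusp γ'' hγ''1 htr'') hγ' htr
    obtain ⟨k, h, M, hh, hanti, hM, hint⟩ := hcover Γ'' hΓ ⟨γ, hγ1, hmem⟩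
    exact CongruenceCore.false_of_antiinvariant_integral_cuspForm_wt hU (NeZero.ne _) hpar
      ⟨γ, hγ1, hmem⟩ h hh hanti hM hint

/-- v1–v3's `stub_gammaOneParity` — THEOREMS A+B in functional form (VERBATIM), as a `Prop`.
(By-name `Prop` handle of this file; no cite tag, not a Literature fact.) -/
def stub_gammaOneParity : Prop :=
    ∀ (W : WeierstrassCurve ℚ) [W.IsElliptic] [W.IsGloballyMinimal] (W₀ : WeierstrassCurve ℚ) [W₀.IsElliptic]
      [W₀.IsGloballyMinimal] ⦃N : ℕ⦄ [NeZero N] (f : CuspForm (Gamma0 N) 2), IsNewformOf W f → IsNewformOf W₀ f →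
      IsOrdinaryAt W 2 → N = W.conductorNorm ℤ →
      ∀ (L₀ : PeriodPair), IsNeronLatticeOf (W₀.baseChange ℂ) L₀ → ∀ (q : ℚ), q ≠ 0 →
      (∀ z ∈ periodLattice f, (q : ℂ) * z ∈ L₀.lattice) → (∀ z ∈ L₀.lattice, ∃ w ∈ periodLattice f, z = (q : ℂ) * w) →
      ∀ (x₀ : ℚ), HasRationalTwoTorsionX W₀ x₀ → ¬ TwoTorsionRamifiedAtTwo x₀ →
      ∀ (lam : ℂ), lam ∈ L₀.lattice → lam / 2 ∉ L₀.lattice →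
      L₀.weierstrassP (lam / 2) - ((W₀.b₂ : ℚ) : ℂ) / 12 = ((x₀ : ℚ) : ℂ) →
      (∃ β : ℕ → ℕ, IsAdmissibleStabData (W.conductorNorm ℤ) β) →
      ∃ β : ℕ → ℕ, IsAdmissibleStabData (W.conductorNorm ℤ) β ∧ ∀ g' : ℚ,
        (∀ x : ℚ, (∃ γ : Gamma0 N,
          stabEisensteinPeriod (W.conductorNorm ℤ) β ((γ : SL(2, ℤ)) 0 0) ((γ : SL(2, ℤ)) 0 1)
            ((γ : SL(2, ℤ)) 1 0) ((γ : SL(2, ℤ)) 1 1) = x) ↔ ∃ n : ℤ, x = n * g') →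
        g' ≠ 0 ∧
        (∀ γ : Gamma0 N, (N : ℤ) ∣ (γ : SL(2, ℤ)) 1 1 - 1 → ∀ n : ℤ,
          stabEisensteinPeriod (W.conductorNorm ℤ) β ((γ : SL(2, ℤ)) 0 0) ((γ : SL(2, ℤ)) 0 1)
            ((γ : SL(2, ℤ)) 1 0) ((γ : SL(2, ℤ)) 1 1) = n * g' →
          (Even n ↔ ∃ k : ℤ, ∃ w ∈ L₀.lattice, (q : ℂ) * cuspSymbol f γ = (k : ℂ) * lam + 2 * w)) ∧
        (∃ b d : ℤ, 0 < d ∧ Int.gcd d (b * (W.conductorNorm ℤ : ℕ)) = 1 ∧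
          ∃ n' : ℤ, stabEisensteinPeriod (W.conductorNorm ℤ) β (Int.gcdA d (b * (W.conductorNorm ℤ : ℕ))) b
            (-((W.conductorNorm ℤ : ℕ) : ℤ) * Int.gcdB d (b * (W.conductorNorm ℤ : ℕ))) d = n' * g' ∧ Odd n')

/-- **v6 GLUE (kernel-checked, no sorry): v5's cover statement from the three OPEN stubs** — (ii-b) from `stub_discrepancyCover`,
`W₀.conductorNorm ℤ = N` from `stub_levelEqConductor` (Carayol at `(W₀, f)`), (o) + (ii-a) + (iii) from the tree (`cover_clauses_of_curveData`). -/
theorem gammaOneCover_of_cut : stub_levelEqConductor → stub_discrepancyCover → stub_gammaOneCover := by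
  intro h4 hD W _ _ W₀ _ _ N _ f hf hf₀ hord hN L₀ hL₀ q hq h₁ h₂ x₀ hx hnr lam hlam hlam₂ hP hβ
  dsimp only [stub_levelEqConductor, stub_discrepancyCover] at h4 hD
  have hN₀ : W₀.conductorNorm ℤ = N := ((h4 N) hf₀).symm
  obtain ⟨β, hadm, hc⟩ := hD W W₀ f hf hf₀ hord hN hN₀ L₀ hL₀ q hq h₁ h₂ x₀ hx hnr lam hlam hlam₂ hP hβ
  refine ⟨β, hadm, fun g' hg ↦ ?_⟩
  obtain ⟨ho, hiia, hiii⟩ :=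
    Summit.BirchSwinnertonDyer.BirchSwinnertonDyer.Theorems.DepletionAtTwo.CuspEvenness.cover_clauses_of_curveData
      W W₀ hord hN hN₀ hx hnr hadm hg
  exact ⟨ho, hiia, hc g' hg, hiii⟩

/-! ### The bundled Γ₁-law (v1's registered stub 1, DERIVED from stubs 1a + 1b) -/

/-- `GammaOneLaw` — the statement of v1's research stub `stub_gammaOneLaw` (2026-08-28T10:27Z registration): admissible
`β` and a scale `g' ≠ 0` with (i) `φ_β(Γ₀(N)) ⊆ ℤ·g'`, (ii) the parity law on `Γ₁(N)`, (iii) an odd Bézout value.  No longer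
a stub: it follows from `stub_eisImageCyclic` (take `g'` = the generator) and `stub_gammaOneParity` (`gammaOneLaw_of`).
(By-name `Prop` handle of this file; no cite tag, not a Literature fact.) -/
def GammaOneLaw : Prop :=
    ∀ (W : WeierstrassCurve ℚ) [W.IsElliptic] [W.IsGloballyMinimal] (W₀ : WeierstrassCurve ℚ) [W₀.IsElliptic]
      [W₀.IsGloballyMinimal] ⦃N : ℕ⦄ [NeZero N] (f : CuspForm (Gamma0 N) 2), IsNewformOf W f → IsNewformOf W₀ f →
      IsOrdinaryAt W 2 → N = W.conductorNorm ℤ →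
      ∀ (L₀ : PeriodPair), IsNeronLatticeOf (W₀.baseChange ℂ) L₀ → ∀ (q : ℚ), q ≠ 0 →
      (∀ z ∈ periodLattice f, (q : ℂ) * z ∈ L₀.lattice) → (∀ z ∈ L₀.lattice, ∃ w ∈ periodLattice f, z = (q : ℂ) * w) →
      ∀ (x₀ : ℚ), HasRationalTwoTorsionX W₀ x₀ → ¬ TwoTorsionRamifiedAtTwo x₀ →
      ∀ (lam : ℂ), lam ∈ L₀.lattice → lam / 2 ∉ L₀.lattice →
      L₀.weierstrassP (lam / 2) - ((W₀.b₂ : ℚ) : ℂ) / 12 = ((x₀ : ℚ) : ℂ) →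
      (∃ β : ℕ → ℕ, IsAdmissibleStabData (W.conductorNorm ℤ) β) →
      ∃ β : ℕ → ℕ, IsAdmissibleStabData (W.conductorNorm ℤ) β ∧ ∃ g' : ℚ, g' ≠ 0 ∧
        (∀ γ : Gamma0 N, ∃ n : ℤ,
          stabEisensteinPeriod (W.conductorNorm ℤ) β ((γ : SL(2, ℤ)) 0 0) ((γ : SL(2, ℤ)) 0 1)
            ((γ : SL(2, ℤ)) 1 0) ((γ : SL(2, ℤ)) 1 1) = n * g') ∧
        (∀ γ : Gamma0 N, (N : ℤ) ∣ (γ : SL(2, ℤ)) 1 1 - 1 → ∀ n : ℤ,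
          stabEisensteinPeriod (W.conductorNorm ℤ) β ((γ : SL(2, ℤ)) 0 0) ((γ : SL(2, ℤ)) 0 1)
            ((γ : SL(2, ℤ)) 1 0) ((γ : SL(2, ℤ)) 1 1) = n * g' →
          (Even n ↔ ∃ k : ℤ, ∃ w ∈ L₀.lattice, (q : ℂ) * cuspSymbol f γ = (k : ℂ) * lam + 2 * w)) ∧
        (∃ b d : ℤ, 0 < d ∧ Int.gcd d (b * (W.conductorNorm ℤ : ℕ)) = 1 ∧
          ∃ n' : ℤ, stabEisensteinPeriod (W.conductorNorm ℤ) β (Int.gcdA d (b * (W.conductorNorm ℤ : ℕ))) b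
            (-((W.conductorNorm ℤ : ℕ) : ℤ) * Int.gcdB d (b * (W.conductorNorm ℤ : ℕ))) d = n' * g' ∧ Odd n')

/-- v1's bundled law from the two new stubs: the generator of the cyclic period group (stub 1a) is the scale; stub 1b
gives `g' ≠ 0`, (ii) and (iii); (i) is the generator property itself. (kernel-checked, no sorry) -/
theorem gammaOneLaw_of : stub_gammaOneParity → GammaOneLaw := by
  intro hP W _ _ W₀ _ _ N _ f hf hf₀ hord hN L₀ hL₀ q hq hin hout x₀ hx₀ hnr lam hlam hlam2 h℘ hβ
  have hE : stub_eisImageCyclic := KummerStubs.stub_eisImageCyclic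
  dsimp only [stub_eisImageCyclic, stub_gammaOneParity] at hE hP
  obtain ⟨β, hadm, hP'⟩ := hP W W₀ f hf hf₀ hord hN L₀ hL₀ q hq hin hout x₀ hx₀ hnr lam hlam hlam2 h℘ hβ
  subst hN
  obtain ⟨g', hg⟩ := hE (W.conductorNorm ℤ) β (NeZero.ne _) hadm
  obtain ⟨hg0, hlaw, hodd⟩ := hP' g' hg
  refine ⟨β, hadm, g', hg0, ?_, hlaw, hodd⟩
  intro γ
  obtain ⟨n, hn⟩ := (hg _).mp ⟨γ, rfl⟩
  exact ⟨n, hn⟩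

end Summit.BirchSwinnertonDyer.BirchSwinnertonDyer.Theorems.DepletionAtTwo.KummerDoor

end
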